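import Summits.CriticalPhenomena.CardyFormulaZ2.Theses.CardyGluingRDE

/-!
# Record of the replaced route item `CardyGluingRDE.JunctionShadowing` (stmt-CriticalPhenomena-8581)

Route `CriticalPhenomena/CardyGluingRDE` replaced its item `JunctionShadowing`
(stmt-CriticalPhenomena-8581) by a restated successor after it was closed `refuted` by
`Summit.CriticalPhenomena.CardyFormulaZ2.Theorems.CardyGluingRDEJunctionShadowing_refuted`
(`Theorems/CardyGluingRDEJunctionShadowingRefutation.lean`). The gate-written route file
`Theses/CardyGluingRDE.lean` therefore no longer declares the constant, while the refutation — a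
Theorems file, append-only, whose statement text may not change — still names it (in the theorem
and in its definitional mirror `iff_mirror`; "Unknown identifier", full builds of 2026-08-16). This
module re-declares the constant under its ORIGINAL fully-qualified name with its ORIGINAL definiens
(the item's ledger signature, verbatim, in the route file's namespace and `open` context), so that
the refutation record elaborates again (`iff_mirror` stays `Iff.rfl`); it is imported by that file
only (391 lines, too close to the 400-line cap for an in-file record). NOT a route item (no
`route_item` attribute); FALSE (see the refutation).
-/

namespace Summit.CriticalPhenomena.CardyFormulaZ2.Theses.CardyGluingRDE

open scoped BigOperators Topology Manifold Classical MeasureTheory ProbabilityTheory Matrix InnerProductSpace ComplexConjugate ContinuousMap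
open Filter Set Function TopologicalSpace MeasureTheory

/-- **Record of the replaced route item `JunctionShadowing`** = stmt-CriticalPhenomena-8581 (ledger
signature verbatim; NOT a route item; FALSE — `Theorems.CardyGluingRDEJunctionShadowing_refuted`).
Re-declared only so that the refutation record keeps elaborating (see the module docstring). -/
def JunctionShadowing : Prop :=
  let PZ := Literature.Probability.Percolation.bondPercolation (Literature.Probability.LatticeModels.zdGraph 2) Literature.Probability.Percolation.half; let ΩL : ℝ → Set ℂ := fun δ₀ => {z : ℂ | 0 < z.re ∧ z.re < δ₀ ∧ 0 < z.im ∧ z.im < δ₀}; let ΩR : ℝ → Set ℂ := fun δ₀ => {z : ℂ | δ₀ < z.re ∧ z.re < 2 * δ₀ ∧ 0 < z.im ∧ z.im < δ₀}; let Ω : ℝ → Set ℂ := fun δ₀ => {z : ℂ | 0 < z.re ∧ z.re < 2 * δ₀ ∧ 0 < z.im ∧ z.im < δ₀}; let outer : (δ₀ : ℝ) → (r : ℕ) → Fin 6 × Fin (2 ^ r) → Set ℂ := fun δ₀ r a => {z : ℂ | (a.1 = 0 ∧ z.im = 0 ∧ δ₀ * ((a.2 : ℕ) : ℝ) / 2 ^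 r ≤ z.re ∧ z.re ≤ δ₀ * (((a.2 : ℕ) : ℝ) + 1) / 2 ^ r) ∨ (a.1 = 1 ∧ z.im = 0 ∧ δ₀ + δ₀ * ((a.2 : ℕ) : ℝ) / 2 ^ r ≤ z.re ∧ z.re ≤ δ₀ + δ₀ * (((a.2 : ℕ) : ℝ) + 1) / 2 ^ r) ∨ (a.1 = 2 ∧ z.re = 2 * δ₀ ∧ δ₀ * ((a.2 : ℕ) : ℝ) / 2 ^ r ≤ z.im ∧ z.im ≤ δ₀ * (((a.2 : ℕ) : ℝ) + 1) / 2 ^ r) ∨ (a.1 = 3 ∧ z.im = δ₀ ∧ δ₀ + δ₀ * ((a.2 : ℕ) : ℝ) / 2 ^ r ≤ z.re ∧ z.re ≤ δ₀ + δ₀ * (((a.2 : ℕ) : ℝ) + 1) / 2 ^ r) ∨ (a.1 = 4 ∧ z.im = δ₀ ∧ δ₀ * ((a.2 : ℕ) : ℝ) / 2 ^ r ≤ z.re ∧ z.re ≤ δ₀ * (((a.2 : ℕ) : ℝ) + 1) / 2 ^ r) ∨ (a.1 = 5 ∧ z.re = 0 ∧ δ₀ * ((a.2 : ℕ) : ℝ)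 / 2 ^ r ≤ z.im ∧ z.im ≤ δ₀ * (((a.2 : ℕ) : ℝ) + 1) / 2 ^ r)}; let seam : (δ₀ : ℝ) → (j : ℕ) → Fin (2 ^ j) → Set ℂ := fun δ₀ j t => {z : ℂ | z.re = δ₀ ∧ δ₀ * ((t : ℕ) : ℝ) / 2 ^ j ≤ z.im ∧ z.im ≤ δ₀ * (((t : ℕ) : ℝ) + 1) / 2 ^ j}; let isL : Fin 6 → Prop := fun e => e = 0 ∨ e = 4 ∨ e = 5; let toSet : (δ₀ : ℝ) → (r j : ℕ) → (Fin 6 × Fin (2 ^ r)) ⊕ Fin (2 ^ j) → Set ℂ := fun δ₀ r j v => Sum.elim (outer δ₀ r) (seam δ₀ j) v; let admL : (r j : ℕ) → (Fin 6 × Fin (2 ^ r)) ⊕ Fin (2 ^ j) → Prop := fun _ _ v => Sum.elim (fun a => isL a.1) (fun _ => True) v; let admR : (r j : ℕ) → (Fin 6 × Fin (2 ^ r)) ⊕ Fin (2 ^ j) → Prop := fun _ _ v => Sum.elim (fun a => ¬ isL a.1) (fun _ => True) v; let rel : (δ₀ : ℝ) → (r j : ℕ) → ℝ → Literature.Probability.Percolation.BondConfig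 (Literature.Probability.LatticeModels.Site 2) → (Fin 6 × Fin (2 ^ r)) ⊕ Fin (2 ^ j) → (Fin 6 × Fin (2 ^ r)) ⊕ Fin (2 ^ j) → Prop := fun δ₀ r j u ω v w => (admL r j v ∧ admL r j w ∧ ω ∈ Literature.Probability.Percolation.discreteCrossing (ΩL δ₀) u (toSet δ₀ r j v) (toSet δ₀ r j w)) ∨ (admR r j v ∧ admR r j w ∧ ω ∈ Literature.Probability.Percolation.discreteCrossing (ΩR δ₀) u (toSet δ₀ r j v) (toSet δ₀ r j w)); let Err : (δ₀ : ℝ) → (r j : ℕ) → ℝ → Set (Literature.Probability.Percolation.BondConfig (Literature.Probability.LatticeModels.Site 2)) := fun δ₀ r j u => {ω | ∃ a b : Fin 6 × Fin (2 ^ r), ¬ (Relation.EqvGen (rel δ₀ r j u ω) (Sum.inl a) (Sum.inl b) ↔ ω ∈ Literature.Probability.Percolation.discreteCrossing (Ω δ₀) u (outer δ₀ r a) (outer δ₀ r b))}; ∃ ε : ℝ, 0 < ε ∧ ∀ r : ℕ, ∃ C : ℝ, 0 < C ∧ ∀ j : ℕ, r ≤ j → ∀ δ₀ : ℝ, 0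 < δ₀ → ∃ δ₁ : ℝ, 0 < δ₁ ∧ ∀ u : ℝ, 0 < u → u < δ₁ → PZ.real (Err δ₀ r j u) ≤ C * (2 : ℝ) ^ (-(ε * ((j : ℝ) - r)))

end Summit.CriticalPhenomena.CardyFormulaZ2.Theses.CardyGluingRDE
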